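import Summits.CriticalPhenomena.PercolationContinuityZ3.Theorems.Transplant.FKConnectivityAllQPat3GenDict
import Summits.CriticalPhenomena.PercolationContinuityZ3.Theorems.Transplant.FKConnectivityAllQPat3FastCheck
import HarnessLib

/-!
# Connectivity correlation inequalities for `φ_{w,q}`, every `q > 0` — THEOREM SP DATA: the RING certificate for `starXTab`,
# part 1 of 3 (Stage S2 data file; 131 products, denominator 16; 125 row-sized kernel evaluations over three files)

Theorems + data file (`--supports stmt-CriticalPhenomena-4575`), census lane `prim-bschramm-census` (gen 36) of the post-continuity programme (LANE 2 bschramm, FK sub-lane);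
builds on p205010 (kernel theorem, internal audit signed; external expert review pending).
No named facts, no sorries; standard axioms (`decide +kernel` only: kernel evaluation, no compiled evaluation).  Census g34's RING certificate for the
target `starXTab` re-derived by LP in ordered pattern tables (131 products), checked by the kernel through `FK.rowG` in 125 small
declarations (rows `(P_K, Q_K, P_1)`; per-declaration memory sized for the smaller farm nodes), `FK.loop1G_of_rows`, and assembled
in part 3 by `FK.symCert_of_pairs` into **`FK.ringStar_level_nonneg`**.
[cite: AyyerLinussonRavichandran2025, §7 eq. (13)–(15) (p. 22)] [cite: Grimmett2006, §3.8 (pp. 61–62)]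
-/

noncomputable section

namespace Summit.CriticalPhenomena.PercolationContinuityZ3.Theorems

namespace FK

open SimpleGraph Literature.Probability.LatticeModels Literature.Probability.Percolation

section Data

/- Sequential elaboration: the kernel evaluations below must not run concurrently (memory on the smaller farm nodes;
census g36 measured: 50 concurrent row evaluations are killed, sequential ones take ≈ 5 s each). -/
set_option Elab.async false

open scoped Classical

variable {V : Type*} [Fintype V]

/-! ### The data -/

/-- The 131 products of the RING certificate for the target `starXTab` (common denominator `16`, shifts `≤ 2`), found by
census g36's LP `code/lp/main.py` in ordered pattern tables: `⟨λ·D, κ, g_K, g_1, g_2⟩`. [folklore] -/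
def prodsRingStar : List Prod3G :=
  [⟨4, 0, Gen.fam tsym2Tab, Gen.fam tsym2Tab, Gen.orb Pat3.all Pat3.all⟩, ⟨2, 0, Gen.fam tsym2Tab, Gen.fam tsym2Tab, Gen.orb Pat3.all Pat3.xy_s⟩,
  ⟨2, 0, Gen.fam tsym2Tab, Gen.fam tsym2Tab, Gen.orb Pat3.all Pat3.ys_x⟩, ⟨1, 0, Gen.fam tsym2Tab, Gen.fam tsym2Tab, Gen.orb Pat3.all Pat3.sep⟩,
  ⟨1, 0, Gen.fam tsym2Tab, Gen.fam tsym2Tab, Gen.orb Pat3.xy_s Pat3.ys_x⟩, ⟨4, 0, Gen.fam tsym2Tab, Gen.fam starXTab, Gen.orb Pat3.all Pat3.all⟩,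
  ⟨4, 0, Gen.fam tsym2Tab, Gen.orb Pat3.all Pat3.all, Gen.fam tsym2Tab⟩, ⟨4, 0, Gen.fam tsym2Tab, Gen.orb Pat3.all Pat3.all, Gen.fam (mirror2 starXTab)⟩,
  ⟨8, 2, Gen.fam tsym2Tab, Gen.orb Pat3.all Pat3.all, Gen.orb Pat3.xy_s Pat3.ys_x⟩, ⟨2, 0, Gen.fam tsym2Tab, Gen.orb Pat3.all Pat3.xy_s, Gen.fam tsym2Tab⟩,
  ⟨4, 1, Gen.fam tsym2Tab, Gen.orb Pat3.all Pat3.xy_s, Gen.orb Pat3.all Pat3.ys_x⟩, ⟨4, 2, Gen.fam tsym2Tab, Gen.orb Pat3.all Pat3.xy_s, Gen.orb Pat3.xy_s Pat3.xs_y⟩,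
  ⟨4, 1, Gen.fam tsym2Tab, Gen.orb Pat3.all Pat3.xy_s, Gen.orb Pat3.xy_s Pat3.ys_x⟩, ⟨2, 0, Gen.fam tsym2Tab, Gen.orb Pat3.all Pat3.xs_y, Gen.fam tsym2Tab⟩,
  ⟨4, 1, Gen.fam tsym2Tab, Gen.orb Pat3.all Pat3.xs_y, Gen.orb Pat3.all Pat3.xy_s⟩, ⟨4, 1, Gen.fam tsym2Tab, Gen.orb Pat3.all Pat3.xs_y, Gen.orb Pat3.all Pat3.ys_x⟩,
  ⟨6, 0, Gen.fam tsym2Tab, Gen.orb Pat3.all Pat3.xs_y, Gen.orb Pat3.xy_s Pat3.xs_y⟩, ⟨4, 1, Gen.fam tsym2Tab, Gen.orb Pat3.all Pat3.xs_y, Gen.orb Pat3.xy_s Pat3.ys_x⟩,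
  ⟨2, 2, Gen.fam tsym2Tab, Gen.orb Pat3.all Pat3.ys_x, Gen.orb Pat3.xy_s Pat3.xs_y⟩, ⟨1, 0, Gen.fam tsym2Tab, Gen.orb Pat3.all Pat3.sep, Gen.fam tsym2Tab⟩,
  ⟨4, 0, Gen.fam tsym2Tab, Gen.orb Pat3.all Pat3.sep, Gen.orb Pat3.xy_s Pat3.xs_y⟩, ⟨1, 0, Gen.fam tsym2Tab, Gen.orb Pat3.xy_s Pat3.xs_y, Gen.fam tsym2Tab⟩,
  ⟨4, 1, Gen.fam tsym2Tab, Gen.orb Pat3.xy_s Pat3.xs_y, Gen.orb Pat3.all Pat3.xy_s⟩, ⟨4, 1, Gen.fam tsym2Tab, Gen.orb Pat3.xy_s Pat3.xs_y, Gen.orb Pat3.all Pat3.ys_x⟩,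
  ⟨2, 0, Gen.fam tsym2Tab, Gen.orb Pat3.xy_s Pat3.xs_y, Gen.orb Pat3.xy_s Pat3.xs_y⟩, ⟨4, 1, Gen.fam tsym2Tab, Gen.orb Pat3.xy_s Pat3.xs_y, Gen.orb Pat3.xy_s Pat3.ys_x⟩,
  ⟨2, 2, Gen.fam tsym2Tab, Gen.orb Pat3.xy_s Pat3.ys_x, Gen.orb Pat3.all Pat3.xs_y⟩, ⟨6, 0, Gen.fam tsym2Tab, Gen.orb Pat3.xy_s Pat3.ys_x, Gen.orb Pat3.all Pat3.ys_x⟩,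
  ⟨4, 0, Gen.fam tsym2Tab, Gen.orb Pat3.xy_s Pat3.ys_x, Gen.orb Pat3.all Pat3.sep⟩, ⟨2, 0, Gen.fam tsym2Tab, Gen.orb Pat3.xy_s Pat3.ys_x, Gen.orb Pat3.xy_s Pat3.ys_x⟩,
  ⟨4, 0, Gen.fam starXTab, Gen.fam starXTab, Gen.orb Pat3.all Pat3.all⟩, ⟨4, 0, Gen.fam (mirror2 starXTab), Gen.orb Pat3.all Pat3.all, Gen.fam (mirror2 starXTab)⟩,
  ⟨2, 0, Gen.fam starSTab, Gen.fam tsym2Tab, Gen.orb Pat3.all Pat3.xy_s⟩, ⟨2, 0, Gen.fam starSTab, Gen.fam (mirror2 starXTab), Gen.orb Pat3.all Pat3.xy_s⟩,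
  ⟨2, 0, Gen.fam starSTab, Gen.fam (mirror2 starXTab), Gen.orb Pat3.all Pat3.xs_y⟩, ⟨1, 0, Gen.fam starSTab, Gen.fam (mirror2 starXTab), Gen.orb Pat3.all Pat3.ys_x⟩,
  ⟨1, 0, Gen.fam starSTab, Gen.fam (mirror2 starXTab), Gen.orb Pat3.all Pat3.sep⟩, ⟨16, 0, Gen.fam starSTab, Gen.orb Pat3.all Pat3.all, Gen.orb Pat3.ys_x Pat3.ys_x⟩,
  ⟨8, 0, Gen.fam starSTab, Gen.orb Pat3.all Pat3.all, Gen.orb Pat3.ys_x Pat3.sep⟩, ⟨2, 0, Gen.fam starSTab, Gen.orb Pat3.all Pat3.xy_s, Gen.fam tsym2Tab⟩,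
  ⟨2, 0, Gen.fam starSTab, Gen.orb Pat3.all Pat3.xy_s, Gen.fam starXTab⟩, ⟨1, 0, Gen.fam starSTab, Gen.orb Pat3.all Pat3.xs_y, Gen.fam starXTab⟩,
  ⟨8, 0, Gen.fam starSTab, Gen.orb Pat3.all Pat3.xs_y, Gen.orb Pat3.all Pat3.ys_x⟩, ⟨6, 0, Gen.fam starSTab, Gen.orb Pat3.all Pat3.xs_y, Gen.orb Pat3.all Pat3.sep⟩,
  ⟨2, 0, Gen.fam starSTab, Gen.orb Pat3.all Pat3.xs_y, Gen.orb Pat3.xy_s Pat3.ys_x⟩, ⟨2, 0, Gen.fam starSTab, Gen.orb Pat3.all Pat3.xs_y, Gen.orb Pat3.xs_y Pat3.ys_x⟩,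
  ⟨12, 0, Gen.fam starSTab, Gen.orb Pat3.all Pat3.xs_y, Gen.orb Pat3.ys_x Pat3.ys_x⟩, ⟨6, 0, Gen.fam starSTab, Gen.orb Pat3.all Pat3.xs_y, Gen.orb Pat3.ys_x Pat3.sep⟩,
  ⟨2, 0, Gen.fam starSTab, Gen.orb Pat3.all Pat3.ys_x, Gen.fam starXTab⟩, ⟨1, 0, Gen.fam starSTab, Gen.orb Pat3.all Pat3.sep, Gen.fam starXTab⟩,
  ⟨6, 0, Gen.fam starSTab, Gen.orb Pat3.all Pat3.sep, Gen.orb Pat3.all Pat3.ys_x⟩, ⟨4, 0, Gen.fam starSTab, Gen.orb Pat3.all Pat3.sep, Gen.orb Pat3.all Pat3.sep⟩,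
  ⟨2, 0, Gen.fam starSTab, Gen.orb Pat3.all Pat3.sep, Gen.orb Pat3.xy_s Pat3.ys_x⟩, ⟨4, 0, Gen.fam starSTab, Gen.orb Pat3.all Pat3.sep, Gen.orb Pat3.ys_x Pat3.ys_x⟩,
  ⟨2, 0, Gen.fam starSTab, Gen.orb Pat3.all Pat3.sep, Gen.orb Pat3.ys_x Pat3.sep⟩, ⟨2, 0, Gen.fam starSTab, Gen.orb Pat3.xy_s Pat3.xs_y, Gen.orb Pat3.all Pat3.ys_x⟩,
  ⟨2, 0, Gen.fam starSTab, Gen.orb Pat3.xy_s Pat3.xs_y, Gen.orb Pat3.all Pat3.sep⟩, ⟨2, 0, Gen.fam starSTab, Gen.orb Pat3.xy_s Pat3.xs_y, Gen.orb Pat3.xs_y Pat3.ys_x⟩,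
  ⟨8, 0, Gen.fam starSTab, Gen.orb Pat3.xy_s Pat3.xs_y, Gen.orb Pat3.ys_x Pat3.ys_x⟩, ⟨4, 0, Gen.fam starSTab, Gen.orb Pat3.xy_s Pat3.xs_y, Gen.orb Pat3.ys_x Pat3.sep⟩,
  ⟨2, 1, Gen.fam starSTab, Gen.orb Pat3.xy_s Pat3.ys_x, Gen.orb Pat3.all Pat3.ys_x⟩, ⟨16, 0, Gen.fam starSTab, Gen.orb Pat3.xs_y Pat3.xs_y, Gen.orb Pat3.all Pat3.all⟩,
  ⟨12, 0, Gen.fam starSTab, Gen.orb Pat3.xs_y Pat3.xs_y, Gen.orb Pat3.all Pat3.ys_x⟩, ⟨4, 0, Gen.fam starSTab, Gen.orb Pat3.xs_y Pat3.xs_y, Gen.orb Pat3.all Pat3.sep⟩,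
  ⟨8, 0, Gen.fam starSTab, Gen.orb Pat3.xs_y Pat3.xs_y, Gen.orb Pat3.xy_s Pat3.ys_x⟩, ⟨8, 0, Gen.fam starSTab, Gen.orb Pat3.xs_y Pat3.xs_y, Gen.orb Pat3.xs_y Pat3.ys_x⟩,
  ⟨16, 0, Gen.fam starSTab, Gen.orb Pat3.xs_y Pat3.xs_y, Gen.orb Pat3.ys_x Pat3.ys_x⟩, ⟨8, 0, Gen.fam starSTab, Gen.orb Pat3.xs_y Pat3.xs_y, Gen.orb Pat3.ys_x Pat3.sep⟩,
  ⟨2, 0, Gen.fam starSTab, Gen.orb Pat3.xs_y Pat3.ys_x, Gen.orb Pat3.all Pat3.ys_x⟩, ⟨2, 0, Gen.fam starSTab, Gen.orb Pat3.xs_y Pat3.ys_x, Gen.orb Pat3.xy_s Pat3.ys_x⟩,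
  ⟨8, 0, Gen.fam starSTab, Gen.orb Pat3.xs_y Pat3.ys_x, Gen.orb Pat3.ys_x Pat3.ys_x⟩, ⟨4, 0, Gen.fam starSTab, Gen.orb Pat3.xs_y Pat3.ys_x, Gen.orb Pat3.ys_x Pat3.sep⟩,
  ⟨8, 0, Gen.fam starSTab, Gen.orb Pat3.xs_y Pat3.sep, Gen.orb Pat3.all Pat3.all⟩, ⟨6, 0, Gen.fam starSTab, Gen.orb Pat3.xs_y Pat3.sep, Gen.orb Pat3.all Pat3.ys_x⟩,
  ⟨2, 0, Gen.fam starSTab, Gen.orb Pat3.xs_y Pat3.sep, Gen.orb Pat3.all Pat3.sep⟩, ⟨4, 0, Gen.fam starSTab, Gen.orb Pat3.xs_y Pat3.sep, Gen.orb Pat3.xy_s Pat3.ys_x⟩,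
  ⟨4, 0, Gen.fam starSTab, Gen.orb Pat3.xs_y Pat3.sep, Gen.orb Pat3.xs_y Pat3.ys_x⟩, ⟨8, 0, Gen.fam starSTab, Gen.orb Pat3.xs_y Pat3.sep, Gen.orb Pat3.ys_x Pat3.ys_x⟩,
  ⟨4, 0, Gen.fam starSTab, Gen.orb Pat3.xs_y Pat3.sep, Gen.orb Pat3.ys_x Pat3.sep⟩, ⟨4, 0, Gen.orb Pat3.all Pat3.all, Gen.fam starXTab, Gen.fam (mirror2 starXTab)⟩,
  ⟨2, 0, Gen.orb Pat3.all Pat3.xs_y, Gen.fam tsym2Tab, Gen.fam (mirror2 starXTab)⟩, ⟨2, 0, Gen.orb Pat3.all Pat3.xs_y, Gen.fam starXTab, Gen.fam (mirror2 starXTab)⟩,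
  ⟨4, 1, Gen.orb Pat3.all Pat3.xs_y, Gen.orb Pat3.all Pat3.xy_s, Gen.fam (mirror2 starXTab)⟩, ⟨4, 1, Gen.orb Pat3.all Pat3.xs_y, Gen.orb Pat3.all Pat3.xs_y, Gen.fam (mirror2 starXTab)⟩,
  ⟨8, 0, Gen.orb Pat3.all Pat3.xs_y, Gen.orb Pat3.all Pat3.ys_x, Gen.fam (mirror2 starXTab)⟩, ⟨4, 1, Gen.orb Pat3.all Pat3.xs_y, Gen.orb Pat3.xy_s Pat3.xs_y, Gen.fam (mirror2 starXTab)⟩,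
  ⟨8, 0, Gen.orb Pat3.all Pat3.xs_y, Gen.orb Pat3.xy_s Pat3.ys_x, Gen.fam (mirror2 starXTab)⟩, ⟨8, 0, Gen.orb Pat3.all Pat3.xs_y, Gen.orb Pat3.xs_y Pat3.ys_x, Gen.fam (mirror2 starXTab)⟩,
  ⟨8, 0, Gen.orb Pat3.all Pat3.xs_y, Gen.orb Pat3.ys_x Pat3.ys_x, Gen.fam (mirror2 starXTab)⟩, ⟨4, 0, Gen.orb Pat3.all Pat3.xs_y, Gen.orb Pat3.ys_x Pat3.sep, Gen.fam (mirror2 starXTab)⟩,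
  ⟨2, 0, Gen.orb Pat3.all Pat3.ys_x, Gen.fam starXTab, Gen.fam tsym2Tab⟩, ⟨2, 0, Gen.orb Pat3.all Pat3.ys_x, Gen.fam starXTab, Gen.fam (mirror2 starXTab)⟩,
  ⟨4, 1, Gen.orb Pat3.all Pat3.ys_x, Gen.fam starXTab, Gen.orb Pat3.all Pat3.xy_s⟩, ⟨8, 0, Gen.orb Pat3.all Pat3.ys_x, Gen.fam starXTab, Gen.orb Pat3.all Pat3.xs_y⟩,
  ⟨4, 1, Gen.orb Pat3.all Pat3.ys_x, Gen.fam starXTab, Gen.orb Pat3.all Pat3.ys_x⟩, ⟨8, 0, Gen.orb Pat3.all Pat3.ys_x, Gen.fam starXTab, Gen.orb Pat3.xy_s Pat3.xs_y⟩,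
  ⟨4, 1, Gen.orb Pat3.all Pat3.ys_x, Gen.fam starXTab, Gen.orb Pat3.xy_s Pat3.ys_x⟩, ⟨8, 0, Gen.orb Pat3.all Pat3.ys_x, Gen.fam starXTab, Gen.orb Pat3.xs_y Pat3.xs_y⟩,
  ⟨8, 0, Gen.orb Pat3.all Pat3.ys_x, Gen.fam starXTab, Gen.orb Pat3.xs_y Pat3.ys_x⟩, ⟨4, 0, Gen.orb Pat3.all Pat3.ys_x, Gen.fam starXTab, Gen.orb Pat3.xs_y Pat3.sep⟩,
  ⟨8, 2, Gen.orb Pat3.xy_s Pat3.xs_y, Gen.fam tsym2Tab, Gen.orb Pat3.all Pat3.all⟩, ⟨8, 0, Gen.orb Pat3.xs_y Pat3.xs_y, Gen.orb Pat3.all Pat3.xy_s, Gen.fam (mirror2 starXTab)⟩,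
  ⟨8, 0, Gen.orb Pat3.xs_y Pat3.xs_y, Gen.orb Pat3.all Pat3.xs_y, Gen.fam (mirror2 starXTab)⟩, ⟨16, 0, Gen.orb Pat3.xs_y Pat3.xs_y, Gen.orb Pat3.all Pat3.ys_x, Gen.fam (mirror2 starXTab)⟩,
  ⟨8, 0, Gen.orb Pat3.xs_y Pat3.xs_y, Gen.orb Pat3.all Pat3.sep, Gen.fam (mirror2 starXTab)⟩, ⟨8, 0, Gen.orb Pat3.xs_y Pat3.xs_y, Gen.orb Pat3.xy_s Pat3.ys_x, Gen.fam (mirror2 starXTab)⟩,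
  ⟨8, 0, Gen.orb Pat3.xs_y Pat3.xs_y, Gen.orb Pat3.xs_y Pat3.ys_x, Gen.fam (mirror2 starXTab)⟩, ⟨16, 0, Gen.orb Pat3.xs_y Pat3.xs_y, Gen.orb Pat3.ys_x Pat3.ys_x, Gen.fam (mirror2 starXTab)⟩,
  ⟨8, 0, Gen.orb Pat3.xs_y Pat3.xs_y, Gen.orb Pat3.ys_x Pat3.sep, Gen.fam (mirror2 starXTab)⟩, ⟨1, 1, Gen.orb Pat3.xs_y Pat3.ys_x, Gen.fam tsym2Tab, Gen.fam (mirror2 starXTab)⟩,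
  ⟨8, 1, Gen.orb Pat3.xs_y Pat3.ys_x, Gen.fam tsym2Tab, Gen.orb Pat3.all Pat3.all⟩, ⟨4, 2, Gen.orb Pat3.xs_y Pat3.ys_x, Gen.fam tsym2Tab, Gen.orb Pat3.all Pat3.xy_s⟩,
  ⟨2, 1, Gen.orb Pat3.xs_y Pat3.ys_x, Gen.fam tsym2Tab, Gen.orb Pat3.all Pat3.sep⟩, ⟨2, 2, Gen.orb Pat3.xs_y Pat3.ys_x, Gen.fam tsym2Tab, Gen.orb Pat3.xy_s Pat3.ys_x⟩,
  ⟨1, 1, Gen.orb Pat3.xs_y Pat3.ys_x, Gen.fam starXTab, Gen.fam tsym2Tab⟩, ⟨2, 1, Gen.orb Pat3.xs_y Pat3.ys_x, Gen.fam starXTab, Gen.orb Pat3.xy_s Pat3.ys_x⟩,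
  ⟨8, 1, Gen.orb Pat3.xs_y Pat3.ys_x, Gen.orb Pat3.all Pat3.all, Gen.fam tsym2Tab⟩, ⟨2, 2, Gen.orb Pat3.xs_y Pat3.ys_x, Gen.orb Pat3.all Pat3.xs_y, Gen.fam tsym2Tab⟩,
  ⟨2, 1, Gen.orb Pat3.xs_y Pat3.ys_x, Gen.orb Pat3.all Pat3.sep, Gen.fam tsym2Tab⟩, ⟨2, 2, Gen.orb Pat3.xs_y Pat3.ys_x, Gen.orb Pat3.xy_s Pat3.xs_y, Gen.fam tsym2Tab⟩,
  ⟨2, 1, Gen.orb Pat3.xs_y Pat3.ys_x, Gen.orb Pat3.xy_s Pat3.xs_y, Gen.fam (mirror2 starXTab)⟩, ⟨8, 0, Gen.orb Pat3.xs_y Pat3.sep, Gen.orb Pat3.all Pat3.all, Gen.fam tsym2Tab⟩,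
  ⟨8, 0, Gen.orb Pat3.ys_x Pat3.ys_x, Gen.fam starXTab, Gen.orb Pat3.all Pat3.xy_s⟩, ⟨16, 0, Gen.orb Pat3.ys_x Pat3.ys_x, Gen.fam starXTab, Gen.orb Pat3.all Pat3.xs_y⟩,
  ⟨8, 0, Gen.orb Pat3.ys_x Pat3.ys_x, Gen.fam starXTab, Gen.orb Pat3.all Pat3.ys_x⟩, ⟨8, 0, Gen.orb Pat3.ys_x Pat3.ys_x, Gen.fam starXTab, Gen.orb Pat3.all Pat3.sep⟩,
  ⟨8, 0, Gen.orb Pat3.ys_x Pat3.ys_x, Gen.fam starXTab, Gen.orb Pat3.xy_s Pat3.xs_y⟩, ⟨16, 0, Gen.orb Pat3.ys_x Pat3.ys_x, Gen.fam starXTab, Gen.orb Pat3.xs_y Pat3.xs_y⟩,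
  ⟨8, 0, Gen.orb Pat3.ys_x Pat3.ys_x, Gen.fam starXTab, Gen.orb Pat3.xs_y Pat3.ys_x⟩, ⟨8, 0, Gen.orb Pat3.ys_x Pat3.ys_x, Gen.fam starXTab, Gen.orb Pat3.xs_y Pat3.sep⟩,
  ⟨8, 0, Gen.orb Pat3.ys_x Pat3.sep, Gen.fam tsym2Tab, Gen.orb Pat3.all Pat3.all⟩]

/-- The raw products (tables) of the certificate. [folklore] -/
abbrev prodsLRingStar : List Prod3 := prodsRingStar.map Prod3G.toProd3

/-- The symmetrised target function of the certificate. [folklore] -/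
abbrev tauRingStar : ℕ → Pat3 → Pat3 → Pat3 → Pat3 → Pat3 → Pat3 → ℤ := target3SymF joinRing corrRing starXTab

/-- Every generator of the certificate passes its side condition (family membership / trivial). [folklore] -/
theorem ringStar_ok : (prodsRingStar.all Prod3G.ok) = true := by decide +kernel

/-- The shifts of the certificate are at most `2`. [folklore] -/
theorem ringStar_shift : ((prodsRingStar.map Prod3G.toProd3).all fun p => decide (p.shift ≤ 2)) = true := by decide +kernel

/-! ### Row checks, part 1 (kernel evaluation, one small declaration each) -/

/-- Row `(all, all, all)` of the RingStar certificate check (kernel evaluation). [folklore] -/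
theorem ringStar_row_all_all_all :
    rowG tauRingStar 8 16 2 (prodsLRingStar.filter fun p => suppAt p.gK Pat3.all Pat3.all) Pat3.all Pat3.all Pat3.all = true := by
  decide +kernel

/-- Row `(all, all, xy_s)` of the RingStar certificate check (kernel evaluation). [folklore] -/
theorem ringStar_row_all_all_xy_s :
    rowG tauRingStar 8 16 2 (prodsLRingStar.filter fun p => suppAt p.gK Pat3.all Pat3.all) Pat3.all Pat3.all Pat3.xy_s = true := by
  decide +kernel

/-- Row `(all, all, xs_y)` of the RingStar certificate check (kernel evaluation). [folklore] -/
theorem ringStar_row_all_all_xs_y :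
    rowG tauRingStar 8 16 2 (prodsLRingStar.filter fun p => suppAt p.gK Pat3.all Pat3.all) Pat3.all Pat3.all Pat3.xs_y = true := by
  decide +kernel

/-- Row `(all, all, ys_x)` of the RingStar certificate check (kernel evaluation). [folklore] -/
theorem ringStar_row_all_all_ys_x :
    rowG tauRingStar 8 16 2 (prodsLRingStar.filter fun p => suppAt p.gK Pat3.all Pat3.all) Pat3.all Pat3.all Pat3.ys_x = true := by
  decide +kernel

/-- Row `(all, all, sep)` of the RingStar certificate check (kernel evaluation). [folklore] -/
theorem ringStar_row_all_all_sep :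
    rowG tauRingStar 8 16 2 (prodsLRingStar.filter fun p => suppAt p.gK Pat3.all Pat3.all) Pat3.all Pat3.all Pat3.sep = true := by
  decide +kernel

/-- Row `(all, xy_s, all)` of the RingStar certificate check (kernel evaluation). [folklore] -/
theorem ringStar_row_all_xy_s_all :
    rowG tauRingStar 8 16 2 (prodsLRingStar.filter fun p => suppAt p.gK Pat3.all Pat3.xy_s) Pat3.all Pat3.xy_s Pat3.all = true := by
  decide +kernel

/-- Row `(all, xy_s, xy_s)` of the RingStar certificate check (kernel evaluation). [folklore] -/
theorem ringStar_row_all_xy_s_xy_s :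
    rowG tauRingStar 8 16 2 (prodsLRingStar.filter fun p => suppAt p.gK Pat3.all Pat3.xy_s) Pat3.all Pat3.xy_s Pat3.xy_s = true := by
  decide +kernel

/-- Row `(all, xy_s, xs_y)` of the RingStar certificate check (kernel evaluation). [folklore] -/
theorem ringStar_row_all_xy_s_xs_y :
    rowG tauRingStar 8 16 2 (prodsLRingStar.filter fun p => suppAt p.gK Pat3.all Pat3.xy_s) Pat3.all Pat3.xy_s Pat3.xs_y = true := by
  decide +kernel

/-- Row `(all, xy_s, ys_x)` of the RingStar certificate check (kernel evaluation). [folklore] -/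
theorem ringStar_row_all_xy_s_ys_x :
    rowG tauRingStar 8 16 2 (prodsLRingStar.filter fun p => suppAt p.gK Pat3.all Pat3.xy_s) Pat3.all Pat3.xy_s Pat3.ys_x = true := by
  decide +kernel

/-- Row `(all, xy_s, sep)` of the RingStar certificate check (kernel evaluation). [folklore] -/
theorem ringStar_row_all_xy_s_sep :
    rowG tauRingStar 8 16 2 (prodsLRingStar.filter fun p => suppAt p.gK Pat3.all Pat3.xy_s) Pat3.all Pat3.xy_s Pat3.sep = true := by
  decide +kernel

/-- Row `(all, xs_y, all)` of the RingStar certificate check (kernel evaluation). [folklore] -/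
theorem ringStar_row_all_xs_y_all :
    rowG tauRingStar 8 16 2 (prodsLRingStar.filter fun p => suppAt p.gK Pat3.all Pat3.xs_y) Pat3.all Pat3.xs_y Pat3.all = true := by
  decide +kernel

/-- Row `(all, xs_y, xy_s)` of the RingStar certificate check (kernel evaluation). [folklore] -/
theorem ringStar_row_all_xs_y_xy_s :
    rowG tauRingStar 8 16 2 (prodsLRingStar.filter fun p => suppAt p.gK Pat3.all Pat3.xs_y) Pat3.all Pat3.xs_y Pat3.xy_s = true := by
  decide +kernel

/-- Row `(all, xs_y, xs_y)` of the RingStar certificate check (kernel evaluation). [folklore] -/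
theorem ringStar_row_all_xs_y_xs_y :
    rowG tauRingStar 8 16 2 (prodsLRingStar.filter fun p => suppAt p.gK Pat3.all Pat3.xs_y) Pat3.all Pat3.xs_y Pat3.xs_y = true := by
  decide +kernel

/-- Row `(all, xs_y, ys_x)` of the RingStar certificate check (kernel evaluation). [folklore] -/
theorem ringStar_row_all_xs_y_ys_x :
    rowG tauRingStar 8 16 2 (prodsLRingStar.filter fun p => suppAt p.gK Pat3.all Pat3.xs_y) Pat3.all Pat3.xs_y Pat3.ys_x = true := by
  decide +kernel

/-- Row `(all, xs_y, sep)` of the RingStar certificate check (kernel evaluation). [folklore] -/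
theorem ringStar_row_all_xs_y_sep :
    rowG tauRingStar 8 16 2 (prodsLRingStar.filter fun p => suppAt p.gK Pat3.all Pat3.xs_y) Pat3.all Pat3.xs_y Pat3.sep = true := by
  decide +kernel

/-- Row `(all, ys_x, all)` of the RingStar certificate check (kernel evaluation). [folklore] -/
theorem ringStar_row_all_ys_x_all :
    rowG tauRingStar 8 16 2 (prodsLRingStar.filter fun p => suppAt p.gK Pat3.all Pat3.ys_x) Pat3.all Pat3.ys_x Pat3.all = true := by
  decide +kernel

/-- Row `(all, ys_x, xy_s)` of the RingStar certificate check (kernel evaluation). [folklore] -/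
theorem ringStar_row_all_ys_x_xy_s :
    rowG tauRingStar 8 16 2 (prodsLRingStar.filter fun p => suppAt p.gK Pat3.all Pat3.ys_x) Pat3.all Pat3.ys_x Pat3.xy_s = true := by
  decide +kernel

/-- Row `(all, ys_x, xs_y)` of the RingStar certificate check (kernel evaluation). [folklore] -/
theorem ringStar_row_all_ys_x_xs_y :
    rowG tauRingStar 8 16 2 (prodsLRingStar.filter fun p => suppAt p.gK Pat3.all Pat3.ys_x) Pat3.all Pat3.ys_x Pat3.xs_y = true := by
  decide +kernel

/-- Row `(all, ys_x, ys_x)` of the RingStar certificate check (kernel evaluation). [folklore] -/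
theorem ringStar_row_all_ys_x_ys_x :
    rowG tauRingStar 8 16 2 (prodsLRingStar.filter fun p => suppAt p.gK Pat3.all Pat3.ys_x) Pat3.all Pat3.ys_x Pat3.ys_x = true := by
  decide +kernel

/-- Row `(all, ys_x, sep)` of the RingStar certificate check (kernel evaluation). [folklore] -/
theorem ringStar_row_all_ys_x_sep :
    rowG tauRingStar 8 16 2 (prodsLRingStar.filter fun p => suppAt p.gK Pat3.all Pat3.ys_x) Pat3.all Pat3.ys_x Pat3.sep = true := by
  decide +kernel

/-- Row `(all, sep, all)` of the RingStar certificate check (kernel evaluation). [folklore] -/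
theorem ringStar_row_all_sep_all :
    rowG tauRingStar 8 16 2 (prodsLRingStar.filter fun p => suppAt p.gK Pat3.all Pat3.sep) Pat3.all Pat3.sep Pat3.all = true := by
  decide +kernel

/-- Row `(all, sep, xy_s)` of the RingStar certificate check (kernel evaluation). [folklore] -/
theorem ringStar_row_all_sep_xy_s :
    rowG tauRingStar 8 16 2 (prodsLRingStar.filter fun p => suppAt p.gK Pat3.all Pat3.sep) Pat3.all Pat3.sep Pat3.xy_s = true := by
  decide +kernel

/-- Row `(all, sep, xs_y)` of the RingStar certificate check (kernel evaluation). [folklore] -/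
theorem ringStar_row_all_sep_xs_y :
    rowG tauRingStar 8 16 2 (prodsLRingStar.filter fun p => suppAt p.gK Pat3.all Pat3.sep) Pat3.all Pat3.sep Pat3.xs_y = true := by
  decide +kernel

/-- Row `(all, sep, ys_x)` of the RingStar certificate check (kernel evaluation). [folklore] -/
theorem ringStar_row_all_sep_ys_x :
    rowG tauRingStar 8 16 2 (prodsLRingStar.filter fun p => suppAt p.gK Pat3.all Pat3.sep) Pat3.all Pat3.sep Pat3.ys_x = true := by
  decide +kernel

/-- Row `(all, sep, sep)` of the RingStar certificate check (kernel evaluation). [folklore] -/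
theorem ringStar_row_all_sep_sep :
    rowG tauRingStar 8 16 2 (prodsLRingStar.filter fun p => suppAt p.gK Pat3.all Pat3.sep) Pat3.all Pat3.sep Pat3.sep = true := by
  decide +kernel

/-- Pair `(all, all)` of the RingStar certificate check, from its five rows. [folklore] -/
theorem ringStar_pair_all_all : loop1G tauRingStar 8 16 2 (prodsLRingStar.filter fun p => suppAt p.gK Pat3.all Pat3.all) Pat3.all Pat3.all = true :=
  loop1G_of_rows fun R => by
    cases R; exacts [ringStar_row_all_all_all, ringStar_row_all_all_xy_s, ringStar_row_all_all_xs_y, ringStar_row_all_all_ys_x, ringStar_row_all_all_sep]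

/-- Pair `(all, xy_s)` of the RingStar certificate check, from its five rows. [folklore] -/
theorem ringStar_pair_all_xy_s : loop1G tauRingStar 8 16 2 (prodsLRingStar.filter fun p => suppAt p.gK Pat3.all Pat3.xy_s) Pat3.all Pat3.xy_s = true :=
  loop1G_of_rows fun R => by
    cases R; exacts [ringStar_row_all_xy_s_all, ringStar_row_all_xy_s_xy_s, ringStar_row_all_xy_s_xs_y, ringStar_row_all_xy_s_ys_x, ringStar_row_all_xy_s_sep]

/-- Pair `(all, xs_y)` of the RingStar certificate check, from its five rows. [folklore] -/
theorem ringStar_pair_all_xs_y : loop1G tauRingStar 8 16 2 (prodsLRingStar.filter fun p => suppAt p.gK Pat3.all Pat3.xs_y) Pat3.all Pat3.xs_y = true :=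
  loop1G_of_rows fun R => by
    cases R; exacts [ringStar_row_all_xs_y_all, ringStar_row_all_xs_y_xy_s, ringStar_row_all_xs_y_xs_y, ringStar_row_all_xs_y_ys_x, ringStar_row_all_xs_y_sep]

/-- Pair `(all, ys_x)` of the RingStar certificate check, from its five rows. [folklore] -/
theorem ringStar_pair_all_ys_x : loop1G tauRingStar 8 16 2 (prodsLRingStar.filter fun p => suppAt p.gK Pat3.all Pat3.ys_x) Pat3.all Pat3.ys_x = true :=
  loop1G_of_rows fun R => by
    cases R; exacts [ringStar_row_all_ys_x_all, ringStar_row_all_ys_x_xy_s, ringStar_row_all_ys_x_xs_y, ringStar_row_all_ys_x_ys_x, ringStar_row_all_ys_x_sep]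

/-- Pair `(all, sep)` of the RingStar certificate check, from its five rows. [folklore] -/
theorem ringStar_pair_all_sep : loop1G tauRingStar 8 16 2 (prodsLRingStar.filter fun p => suppAt p.gK Pat3.all Pat3.sep) Pat3.all Pat3.sep = true :=
  loop1G_of_rows fun R => by
    cases R; exacts [ringStar_row_all_sep_all, ringStar_row_all_sep_xy_s, ringStar_row_all_sep_xs_y, ringStar_row_all_sep_ys_x, ringStar_row_all_sep_sep]

end Data

end FK

end Summit.CriticalPhenomena.PercolationContinuityZ3.Theorems

end
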